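import Literature.Claims.NS.Stanley2025
import HarnessLib

/-!
# Kit (typist-7 g2, UNFILED, OFF-PATH face) for `Literature.Claims.NS.Stanley2025` — row C85, erratum column

`not_Step_L11growth`: Lemma 11(4) p.23–24 «Uniform quadratic growth: F_η(s) ≤ C s²/(s+η) for all
s ≥ 0» is false for every constant `C` (typed charitably with `∃ C`): at `η = 1` and
`s = e^{2|C|+2} − 1` one has `F₁(s) = (2|C|+1)s + 2|C| + 2 > |C|·s ≥ C s²/(s+1)`. OFF the composition
path (`claim_of_steps` does not consume it) — for the DOWNSTREAM/erratum cell only; the locator is the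
refuter's (refuter-6 g0) and the referee's (`Step_L14`, Lemma 14 p.26). Nothing here is a claim about
NS regularity or blow-up.

WHAT THIS IS NOT: not a claim about NS regularity or blow-up; not a claim about any author beyond the
typed locator.
-/

set_option linter.dupNamespace false

namespace Summit.NavierStokesRegularity.NavierStokesRegularity.Theorems.Stanley2025

open Literature.Claims.NS.Stanley2025

/-- **Lemma 11(4) p.23–24 fails**: `F_η(s) = (s+η)ln(1+s/η) − s` grows like `s ln s`, not like
`s²/(s+η) ≤ s`. Witness `η = 1`, `s = e^{2|C|+2} − 1`. [cite: Stanley2025, Lemma 11(4) p.23–24] -/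
theorem not_Step_L11growth : ¬ Step_L11growth := by
  intro h
  obtain ⟨C, hC⟩ := h 1 one_pos
  set L : ℝ := 2 * |C| + 2 with hL
  set s : ℝ := Real.exp L - 1 with hs
  have hLpos : 0 < L := by positivity
  have hs_pos : 0 < s := by
    have : 1 < Real.exp L := by
      have := Real.add_one_lt_exp (ne_of_gt hLpos)
      linarith
    linarith
  have hkey := hC s hs_pos.le
  -- F₁(s) = (s + 1) L − s
  have hF : Feta 1 s = (s + 1) * L - s := by
    simp only [Feta, div_one]
    rw [show (1 : ℝ) + s = Real.exp L by rw [hs]; ring, Real.log_exp]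
  -- the printed bound is at most |C|·s
  have hbound : C * (s ^ 2 / (s + 1)) ≤ |C| * s := by
    have h1 : s ^ 2 / (s + 1) ≤ s := by
      rw [div_le_iff₀ (by linarith)]
      nlinarith
    have h2 : 0 ≤ s ^ 2 / (s + 1) := by positivity
    calc C * (s ^ 2 / (s + 1)) ≤ |C| * (s ^ 2 / (s + 1)) :=
          mul_le_mul_of_nonneg_right (le_abs_self C) h2
      _ ≤ |C| * s := mul_le_mul_of_nonneg_left h1 (abs_nonneg C)
  -- but F₁(s) = (2|C|+1)s + (2|C|+2) > |C|·s
  rw [hF] at hkey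
  have habs : 0 ≤ |C| := abs_nonneg C
  have : (s + 1) * L - s = (2 * |C| + 1) * s + (2 * |C| + 2) := by rw [hL]; ring
  rw [this] at hkey
  nlinarith

end Summit.NavierStokesRegularity.NavierStokesRegularity.Theorems.Stanley2025
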